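/-
Copyright (c) 2026 the pub-hodgecm-mathlib formalisation cell (harness21).  Prover seat hodgecm-mathlib-LH4-p18 (g4), req620 Track A «(D-RAM) FOUR-FRAME» squad
(STAGE-1b, row (2) of the piece `f_{T₊}`, the (β₂) road (R-36) «PURE-CELL LEDGER»; β₂ sub-dealer LH4-p04 (g10) WORD #32 «p18: K6-0 PER-CELL LAW», K6-ROAD-BRIEF v1 dfa84314 §2 row 1;
mechanism LH4-p16 (g2) MECH-K3 d766981c §2 ∕ 01:03:04Z (2)), 2026-09-05.
-/
import Summits.HodgeConjecture.HodgeConjecture.Theorems.F0P3cDyRamConeCellCountSocketThree   -- ★ p863833 (LH4-p19 (g2)): the socket frame; brings ★ p862250 `card_filter_comp_eq_mul_of_fibre_const`, ★ `…ConeCellFaceTubeAbove` (two-valued weight), ★ DEFS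
import HarnessLib

/-!
# Crux `H413`, line LH4 «(D-RAM) FOUR-FRAME» — STAGE-1b, row (2), the (β₂) road (R-36), K6-0: «THE PER-CELL LAW OF A CONE CELL» — the labelled weighted count `X(cell)` of ONE literal,
# times the number of literal digits, equals the weighted size `n(cell)` times the label character sum over the literal digits

Cell `hodgecm-mathlib` (D-0151), FLOOR 0, crux item H413 = `stmt-HodgeConjecture-24833`, route of record `HCCMUnconditional`; squad F0∕P3c∕LH4; lane
`--supports stmt-HodgeConjecture-24833 --as helper` (count-neutral; pays NO tier-0 row).  THEOREMS ONLY (no `def`, no instance, no notation, no `sorry`, default heartbeats);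
★-only imports; states NO law; (β₂) stays a HYPOTHESIS; every mathematical input is a HYPOTHESIS of the socket ★ p863833 (its reads are ★: (hV)(hP)(hL) p863914, (hLit) p863983,
(hF) p864078; (hI) LH7-p06 (g3) in flight).
WHAT (β₂ WORD #32; LH4-p16 (g2) MECH-K3 §2 «literal, population, label DECOUPLE on the digit line»).  In the currency of the FROZEN letters (‹FLIPT.v1› 16695a71, ‹CORE-ODD.v1› eff69f00,
‹BDIG.v1›): `n(cell) := Σᶠ_{Λ ∈ cell} f b j Λ` (the WEIGHTED size; unpopulated members weigh `0`) and `X(cell) := Σᶠ_{cell ∩ {P₁}} f − Σᶠ_{cell ∩ {Q₁}} f` (the labelled weighted count of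
one literal), `cell = levelSetDep ρ Θ α (jEϖ) h j b (lam − jE u)`.  With ★ p863833's fibration letters (digit system `Rd` mod `r`, literal `LIT` — which CONTAINS the cell's sphere clause
(★ p863983 v2), so `Rd.filter LIT` IS «`Rd ∩ LIT ∩ shell(cell)`» —, labelled sub-family `NX`, label `ψ`, reads (hP)(hL₁)(hL₂)) and at `d ≤ b` (two-valued weight ★ `…FaceTubeAbove`):
**`X(cell) · #(Rd.filter LIT) = n(cell) · Σ_{V ∈ (Rd.filter LIT).filter NX} (ψ V ? 1 : −1)`** (HEAD §2 `cellDiff_mul_card_eq_cellCount_mul_sum_of_fibration_reads₃`), and with a sign read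
`(ψ V ? 1 : −1) = p · ω V` on the labelled literal digits (e.g. `p = ω(−h_W)`, `ω V = ω(α₁ + γ₁V)`, ★ p863628 ∕ p863859; §3 `ite_eq_normSign_mul_normSign`) the displayed form
**`X(cell) · #(Rd.filter LIT) = n(cell) · p · Σ_{V} ω V`** (§3 HEAD′).  WHY no factor `2`: in the letters' currency `n = Σᶠ f` already counts the POPULATED half only (weight `0` on the other
half), so ★ p863565's halving is not consumed here; it enters only if one reads `n` as the unweighted `#cell` (then `2·Σᶠ f = 2q^b·#cell`).  Mechanism (§1, abstract, socket-agnostic — the same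
lemma serves LH4-p19 (g3)'s off-row `reads₄` once ★): uniform populated fibre `k` over the literal digits (hF) ⇒ `#{pop ∧ φ(digit)} = k·#{LIT ∧ φ}` for every digit-class-constant `φ`
(★ p862250), `#pop = k·#LIT`; multiply out.
WHAT IS NOT CLAIMED: any digit-range bookkeeping (which shells are pure ∕ flip ∕ balanced — K6-(d)(e)), any character sum value (★ LH4-p14), (hI), any census identity; ‹FLIPT›, ‹BDIG›, ‹SDIG›,
‹CORE-3›, ‹CORE-ODD› remain OPEN letters (corollaries of this law + K6-(d)(e)).
HONEST LABEL.  Count-neutral bookkeeping; nothing printed is asserted; no census law is stated; `HC_CM` is proved only modulo the 7 printed citations (2 remaining named inputs: hLiu418 =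
`stmt-HodgeConjecture-24832`, h413 = `stmt-HodgeConjecture-24833`) until rung 0 closes.
## References
* [Kottwitz1986BaseChangeUnits] R. E. Kottwitz, *Base change for unit elements of Hecke algebras*, Compositio Math. 60 (1986): §1 pp. 240–241 (fixed-lattice counts as orbital integrals).
* [LabesseLanglands1979] J.-P. Labesse, R. P. Langlands, *L-indistinguishability for SL(2)*, Canad. J. Math. 31 (1979): §2 (2.2) p. 9 (κ-signed counts).
* [Rogawski1990] J. D. Rogawski, *Automorphic Representations of Unitary Groups in Three Variables*, Ann. of Math. Stud. 123 (1990): §4.9 Prop. 4.9.1 (b) p. 55 (the labelled census of `f_{T₊}`).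
* [Serre1979] J.-P. Serre, *Local Fields*, GTM 67 (1979): Ch. V §3 Prop. 5, Cor. 2–3 pp. 84–86 (norm index two).
-/

set_option autoImplicit false

noncomputable section

namespace Summit.HodgeConjecture.HodgeConjecture.Cruxes.H413.F0P3cDyRamConeCellPerCellLaw

open scoped Valued WithZero Matrix MatrixGroups Classical
open WithZero Finset
open Literature.NumberTheory.Automorphic Literature.NumberTheory.Automorphic.HermitianLattice Literature.NumberTheory.Automorphic.UnitaryLatticeTree
open Literature.NumberTheory.Automorphic.UnitaryThreeFourFrame (IsRamifiedQuadraticDatum normSign)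
open Summit.HodgeConjecture.HodgeConjecture.Cruxes.H413.F0P3cDyRamToricCensusDefs
open Summit.HodgeConjecture.HodgeConjecture.Cruxes.H413.F0P3cDyRamCellBalanceOfFibreHalving (card_filter_comp_eq_mul_of_fibre_const)
open Summit.HodgeConjecture.HodgeConjecture.Cruxes.H413.F0P3cDyRamConeCellFaceTubeAbove (finsum_levelSetDep_inter_weight_eq_two_mul_pow_mul_ncard_of_le)

variable {E M : Type} [Field E] [Valued E ℤᵐ⁰] [Field M] [Valued M ℤᵐ⁰] {σ : E →+* E} {ρ Θ : M →+* M} {α : M}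

/-! ## §1 The abstract law: labelled populated count × #literal digits = populated count × label sum over the literal digits -/

/-- **THE PER-CELL LAW, ABSTRACT (socket-agnostic).**  Letters of ★ p863833 §1 (`GEN`, `CLS`, `Vf`, `ε`, `jE` isometric, digit system `Rd` mod `r` — covering `hRd2`, separated `hRd3` —,
literal `LIT`, labelled sub-family `NX` and label `ψ` constant on digit classes, (hI) generator independence, (hP) preimages, (hL) literal digits, (hF) equal literal fibres of the populated
class, finiteness).  THEN, for the populated class `S = {Λ ∣ ∃ x₀, GEN Λ x₀ ∧ (CLS x₀ ↔ ε)}`: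
`(#{S ∣ digit ∈ NX ∧ ψ} − #{S ∣ digit ∈ NX ∧ ¬ψ}) · #(Rd.filter LIT) = #S · Σ_{V ∈ (Rd.filter LIT).filter NX} (ψ V ? 1 : −1)` — every literal digit carries the same populated fibre `k`
(★ p862250 `card_filter_comp_eq_mul_of_fibre_const`), so both sides are `k·#LIT·(#{LIT ∧ NX ∧ ψ} − #{LIT ∧ NX ∧ ¬ψ})`.
[cite: Kottwitz1986BaseChangeUnits, §1 pp. 240–241] [cite: LabesseLanglands1979, §2 (2.2) p. 9] -/
theorem ncardDiff_mul_card_eq_ncard_mul_sum_of_digit_fibration {X : Type} (GEN : X → M → Prop) (CLS : M → Prop) (Vf : M → M) (ε : Prop)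
    (jE : E →+* M) (hjiso : ∀ a, Valued.v (jE a) = Valued.v a) (r : ℤᵐ⁰)
    (Rd : Finset E) (hRd2 : ∀ V : E, σ V = V → Valued.v V ≤ 1 → ∃ V₀ ∈ Rd, Valued.v (V - V₀) ≤ r)
    (hRd3 : ∀ V ∈ Rd, ∀ V' ∈ Rd, Valued.v (V - V') ≤ r → V = V')
    (LIT NX ψ : E → Prop) [DecidablePred LIT] [DecidablePred NX] [DecidablePred ψ]
    (hI : ∀ (Λ : X) (x₀ x₀' : M), GEN Λ x₀ → GEN Λ x₀' → (CLS x₀ ↔ CLS x₀') ∧ Valued.v (Vf x₀' - Vf x₀) ≤ r)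
    (hP : ∀ (Λ : X) (x₀ : M), GEN Λ x₀ → ∃ Ve : E, jE Ve = Vf x₀ ∧ σ Ve = Ve ∧ Valued.v Ve ≤ 1)
    (hL : ∀ (Λ : X) (x₀ : M) (V₀ : E), GEN Λ x₀ → V₀ ∈ Rd → Valued.v (Vf x₀ - jE V₀) ≤ r → LIT V₀)
    (hNX : ∀ Ve V₀ : E, σ Ve = Ve → Valued.v Ve ≤ 1 → V₀ ∈ Rd → Valued.v (Ve - V₀) ≤ r → (NX Ve ↔ NX V₀))
    (hψ : ∀ Ve V₀ : E, σ Ve = Ve → Valued.v Ve ≤ 1 → V₀ ∈ Rd → Valued.v (Ve - V₀) ≤ r → (ψ Ve ↔ ψ V₀))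
    (hF : ∀ y ∈ Rd.filter LIT, ∀ y' ∈ Rd.filter LIT,
      {Λ : X | ∃ x₀, GEN Λ x₀ ∧ (CLS x₀ ↔ ε) ∧ Valued.v (Vf x₀ - jE y) ≤ r}.ncard =
        {Λ : X | ∃ x₀, GEN Λ x₀ ∧ (CLS x₀ ↔ ε) ∧ Valued.v (Vf x₀ - jE y') ≤ r}.ncard)
    (hfin : {Λ : X | ∃ x₀, GEN Λ x₀}.Finite) :
    (({Λ : X | ∃ x₀, GEN Λ x₀ ∧ (CLS x₀ ↔ ε) ∧ ∃ Ve : E, jE Ve = Vf x₀ ∧ NX Ve ∧ ψ Ve}.ncard : ℤ) -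
        ({Λ : X | ∃ x₀, GEN Λ x₀ ∧ (CLS x₀ ↔ ε) ∧ ∃ Ve : E, jE Ve = Vf x₀ ∧ NX Ve ∧ ¬ ψ Ve}.ncard : ℤ)) * ((Rd.filter LIT).card : ℤ) =
      ({Λ : X | ∃ x₀, GEN Λ x₀ ∧ (CLS x₀ ↔ ε)}.ncard : ℤ) * ∑ V ∈ (Rd.filter LIT).filter NX, (if ψ V then (1 : ℤ) else -1) := by
  -- (adapted from ★ p863833 §1 `ncard_eq_ncard_of_digit_fibration₂`: the digit map `π` and the populated class `S`)
  set B : Finset E := Rd.filter LIT with hB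
  -- the digit of a lattice: a literal digit within `r` of a coordinate
  have hdig : ∀ Λ : X, (∃ x₀, GEN Λ x₀) → ∃ V₀ ∈ B, ∃ x₀, GEN Λ x₀ ∧ Valued.v (Vf x₀ - jE V₀) ≤ r := by
    rintro Λ ⟨x₀, hG⟩
    obtain ⟨Ve, hjVe, hσVe, hVe1⟩ := hP Λ x₀ hG
    obtain ⟨V₀, hV₀R, hnear⟩ := hRd2 Ve hσVe hVe1
    have hnearM : Valued.v (Vf x₀ - jE V₀) ≤ r := by rw [← hjVe, ← map_sub, hjiso]; exact hnear
    exact ⟨V₀, mem_filter.2 ⟨hV₀R, hL Λ x₀ V₀ hG hV₀R hnearM⟩, x₀, hG, hnearM⟩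
  choose! π hπB hπnear using hdig
  -- the digit is unique: for any generator, `|Vf x₀ − jE V₀| ≤ r ↔ π Λ = V₀`
  have hπuniq : ∀ (Λ : X) (x₀ : M) (V₀ : E), GEN Λ x₀ → V₀ ∈ Rd → (Valued.v (Vf x₀ - jE V₀) ≤ r ↔ π Λ = V₀) := by
    intro Λ x₀ V₀ hG hV₀R
    obtain ⟨x₁, hG₁, h₁⟩ := hπnear Λ ⟨x₀, hG⟩
    have hI₁ : Valued.v (Vf x₁ - Vf x₀) ≤ r := (hI Λ x₀ x₁ hG hG₁).2
    have hπR : π Λ ∈ Rd := (mem_filter.1 (hπB Λ ⟨x₀, hG⟩)).1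
    constructor
    · intro h0
      refine hRd3 _ hπR _ hV₀R ?_
      rw [← hjiso, map_sub]
      have e : jE (π Λ) - jE V₀ = (Vf x₀ - jE V₀) - (Vf x₁ - jE (π Λ)) + (Vf x₁ - Vf x₀) := by ring
      rw [e]
      exact (Valuation.map_add _ _ _).trans (max_le ((Valuation.map_sub _ _ _).trans (max_le h0 h₁)) hI₁)
    · rintro rfl
      have e : Vf x₀ - jE (π Λ) = (Vf x₁ - jE (π Λ)) - (Vf x₁ - Vf x₀) := by ring
      rw [e]
      exact (Valuation.map_sub _ _ _).trans (max_le h₁ hI₁)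
  -- the populated class `S` as a finite set
  set S : Finset X := hfin.toFinset.filter (fun Λ => ∃ x₀, GEN Λ x₀ ∧ (CLS x₀ ↔ ε)) with hS
  have hmemS : ∀ Λ, Λ ∈ S ↔ ∃ x₀, GEN Λ x₀ ∧ (CLS x₀ ↔ ε) := by
    intro Λ
    rw [hS, mem_filter, Set.Finite.mem_toFinset, Set.mem_setOf_eq]
    exact ⟨fun hh => hh.2, fun hh => ⟨(by obtain ⟨x₀, hG, -⟩ := hh; exact ⟨x₀, hG⟩), hh⟩⟩
  have hSB : ∀ Λ ∈ S, π Λ ∈ B := fun Λ hΛ => by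
    obtain ⟨x₀, hG, -⟩ := (hmemS Λ).1 hΛ
    exact hπB Λ ⟨x₀, hG⟩
  -- the fibres of `π` over the digits are the `∃`-fibres
  have hcardfib : ∀ y ∈ Rd, (S.filter fun Λ => π Λ = y).card = {Λ : X | ∃ x₀, GEN Λ x₀ ∧ (CLS x₀ ↔ ε) ∧ Valued.v (Vf x₀ - jE y) ≤ r}.ncard := by
    intro y hy
    have hset : ((S.filter fun Λ => π Λ = y) : Set X) = {Λ : X | ∃ x₀, GEN Λ x₀ ∧ (CLS x₀ ↔ ε) ∧ Valued.v (Vf x₀ - jE y) ≤ r} := by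
      ext Λ
      simp only [coe_filter, Set.mem_setOf_eq, hmemS]
      constructor
      · rintro ⟨⟨x₀, hG, hC⟩, hπ⟩
        exact ⟨x₀, hG, hC, (hπuniq Λ x₀ y hG hy).2 hπ⟩
      · rintro ⟨x₀, hG, hC, hn⟩
        exact ⟨⟨x₀, hG, hC⟩, (hπuniq Λ x₀ y hG hy).1 hn⟩
    rw [← hset, Set.ncard_coe_finset]
  -- the fibres over the literal digits have one size `k`
  obtain ⟨k, hk⟩ : ∃ k : ℕ, ∀ y ∈ B, (S.filter fun Λ => π Λ = y).card = k := by
    by_cases hBne : B.Nonempty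
    · obtain ⟨y₀, hy₀⟩ := hBne
      refine ⟨(S.filter fun Λ => π Λ = y₀).card, fun y hy => ?_⟩
      rw [hcardfib y (mem_filter.1 hy).1, hcardfib y₀ (mem_filter.1 hy₀).1]
      exact hF y hy y₀ hy₀
    · exact ⟨0, fun y hy => absurd ⟨y, hy⟩ hBne⟩
  -- the counts through the digit map (★ p862250)
  have hcnt : ∀ (φ : E → Prop) [DecidablePred φ], (S.filter fun Λ => φ (π Λ)).card = k * (B.filter φ).card :=
    fun φ _ => card_filter_comp_eq_mul_of_fibre_const S π B hSB k hk φ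
  have hcardS : S.card = k * B.card := by
    have h1 := hcnt (fun _ => True)
    rwa [filter_true_of_mem (fun _ _ => trivial), filter_true_of_mem (fun _ _ => trivial)] at h1
  -- identify the sides: the label of a lattice is the label of its digit
  have hside : ∀ (φ : E → Prop) [DecidablePred φ], (∀ Ve V₀ : E, σ Ve = Ve → Valued.v Ve ≤ 1 → V₀ ∈ Rd → Valued.v (Ve - V₀) ≤ r → (φ Ve ↔ φ V₀)) →
      ((S.filter fun Λ => φ (π Λ)) : Set X) = {Λ : X | ∃ x₀, GEN Λ x₀ ∧ (CLS x₀ ↔ ε) ∧ ∃ Ve : E, jE Ve = Vf x₀ ∧ φ Ve} := by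
    intro φ _ hφ
    ext Λ
    simp only [coe_filter, Set.mem_setOf_eq, hmemS]
    constructor
    · rintro ⟨⟨x₀, hG, hC⟩, hφπ⟩
      obtain ⟨Ve, hjVe, hσVe, hVe1⟩ := hP Λ x₀ hG
      have hπR : π Λ ∈ Rd := (mem_filter.1 (hπB Λ ⟨x₀, hG⟩)).1
      have hnear : Valued.v (Ve - π Λ) ≤ r := by
        rw [← hjiso, map_sub, hjVe]; exact (hπuniq Λ x₀ (π Λ) hG hπR).2 rfl
      exact ⟨x₀, hG, hC, Ve, hjVe, (hφ Ve (π Λ) hσVe hVe1 hπR hnear).2 hφπ⟩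
    · rintro ⟨x₀, hG, hC, Ve, hjVe, hφVe⟩
      have hπR : π Λ ∈ Rd := (mem_filter.1 (hπB Λ ⟨x₀, hG⟩)).1
      obtain ⟨Ve', hjVe', hσVe, hVe1⟩ := hP Λ x₀ hG
      have hVV : Ve' = Ve := jE.injective (by rw [hjVe', hjVe])
      rw [hVV] at hσVe hVe1
      have hnear : Valued.v (Ve - π Λ) ≤ r := by
        rw [← hjiso, map_sub, hjVe]; exact (hπuniq Λ x₀ (π Λ) hG hπR).2 rfl
      exact ⟨⟨x₀, hG, hC⟩, (hφ Ve (π Λ) hσVe hVe1 hπR hnear).1 hφVe⟩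
  have hψ₁ : ∀ Ve V₀ : E, σ Ve = Ve → Valued.v Ve ≤ 1 → V₀ ∈ Rd → Valued.v (Ve - V₀) ≤ r → ((NX Ve ∧ ψ Ve) ↔ (NX V₀ ∧ ψ V₀)) :=
    fun Ve V₀ h1 h2 h3 h4 => and_congr (hNX Ve V₀ h1 h2 h3 h4) (hψ Ve V₀ h1 h2 h3 h4)
  have hψ₂ : ∀ Ve V₀ : E, σ Ve = Ve → Valued.v Ve ≤ 1 → V₀ ∈ Rd → Valued.v (Ve - V₀) ≤ r → ((NX Ve ∧ ¬ ψ Ve) ↔ (NX V₀ ∧ ¬ ψ V₀)) :=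
    fun Ve V₀ h1 h2 h3 h4 => and_congr (hNX Ve V₀ h1 h2 h3 h4) (not_congr (hψ Ve V₀ h1 h2 h3 h4))
  have hS' : (S : Set X) = {Λ : X | ∃ x₀, GEN Λ x₀ ∧ (CLS x₀ ↔ ε)} := by
    ext Λ; rw [mem_coe, hmemS, Set.mem_setOf_eq]
  rw [← hside (fun V => NX V ∧ ψ V) hψ₁, ← hside (fun V => NX V ∧ ¬ ψ V) hψ₂, ← hS', Set.ncard_coe_finset, Set.ncard_coe_finset, Set.ncard_coe_finset,
    hcnt (fun V => NX V ∧ ψ V), hcnt (fun V => NX V ∧ ¬ ψ V), hcardS]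
  -- the label sum over the labelled literal digits is `#{NX ∧ ψ} − #{NX ∧ ¬ψ}`
  have hsum : ∑ V ∈ B.filter NX, (if ψ V then (1 : ℤ) else -1) = (((B.filter NX).filter ψ).card : ℤ) - (((B.filter NX).filter fun V => ¬ ψ V).card : ℤ) := by
    rw [sum_ite, sum_const, sum_const, nsmul_eq_mul, nsmul_eq_mul, mul_one, mul_neg, mul_one, sub_eq_add_neg]
  rw [hsum, Finset.filter_filter NX ψ B, Finset.filter_filter NX (fun V => ¬ ψ V) B]
  push_cast
  ring

/-! ## §2 HEAD — the per-cell law in the socket's currency (`d ≤ b`, row cells: `levelSetDep = levelSet`) -/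

/-- **HEAD — «THE PER-CELL LAW OF A CONE CELL» (K6-0).**  Frame of ★ p863833 `cellDiff_eq_zero_of_fibration_reads₃` VERBATIM MINUS the balance letter `hbase` (★ `…ConeCellFaceTubeAbove`'s
frame `σ hσ hvσ ϖ hϖ d t hD h2v H₂ hH₂σ hW hhW hhWσ jE hρρ hvρ hα hα1 hint hΘΘ hΘρ hvΘ hΘj hjv hjfix hjpow hϖmax φ hφs hφi hφo γ₂ lam h hφγ hlam hΘh hh hform (u : E) b hb (hdb : d ≤ b) j hlamj f hf`
+ `hjiso` + `hcell` + `hfin` + the fibration letters `CLS Vf ε r Rd hRd2 hRd3 LIT NX ψ hI hV hLit hNX hψ hF` + the reads `P₁ Q₁ hP hL₁ hL₂`).  THEN, with `cell = levelSetDep ρ Θ α (jEϖ) h j b (lam − jE u)`,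
`X(cell) := Σᶠ_{cell ∩ {P₁}} f b j − Σᶠ_{cell ∩ {Q₁}} f b j` and `n(cell) := Σᶠ_{cell} f b j` (the letters' currency):
`X(cell) · #(Rd.filter LIT) = n(cell) · Σ_{V ∈ (Rd.filter LIT).filter NX} (ψ V ? 1 : −1)`.  (Weights `2q^b ∨ 0` ★ `finsum_levelSetDep_inter_weight_eq_two_mul_pow_mul_ncard_of_le`; §1.)
[cite: Kottwitz1986BaseChangeUnits, §1 pp. 240–241] [cite: LabesseLanglands1979, §2 (2.2) p. 9] [cite: Rogawski1990, §4.9 Prop. 4.9.1 (b) p. 55] [cite: Serre1979, Ch. V §3 Prop. 5, Cor. 2–3 pp. 84–86] -/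
theorem cellDiff_mul_card_eq_cellCount_mul_sum_of_fibration_reads₃ [CompleteSpace E] [IsDiscreteValuationRing 𝒪[E]] [Finite 𝓀[E]]
    (σ : E →+* E) (hσ : ∀ a, σ (σ a) = a) (hvσ : ∀ a, Valued.v (σ a) = Valued.v a)
    {ϖ : E} (hϖ : Valued.v ϖ = WithZero.exp (-1 : ℤ)) {d t : ℕ} (hD : IsRamifiedQuadraticDatum σ ϖ d t) (h2v : Valued.v (2 : E) < 1)
    {H₂ : Matrix (Fin 2) (Fin 2) E} (hH₂σ : (H₂.map σ)ᵀ = H₂) {hW : E} (hhW : Valued.v hW = 1) (hhWσ : σ hW = hW) (jE : E →+* M)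
    (hρρ : ∀ x, ρ (ρ x) = x) (hvρ : ∀ x, Valued.v (ρ x) = Valued.v x) (hα : ρ α ≠ α) (hα1 : Valued.v α ≤ 1)
    (hint : ∀ z : M, Valued.v z ≤ 1 → Valued.v ((z - ρ z) / (α - ρ α)) ≤ 1)
    (hΘΘ : ∀ x, Θ (Θ x) = x) (hΘρ : ∀ x, Θ (ρ x) = ρ (Θ x)) (hvΘ : ∀ x, Valued.v (Θ x) = Valued.v x) (hΘj : ∀ x, Θ (jE x) = jE (σ x))
    (hjv : ∀ c, Valued.v (jE c) ≤ 1 ↔ Valued.v c ≤ 1) (hjfix : ∀ z, ρ z = z ↔ ∃ c, jE c = z)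
    (hjpow : ∀ (t : E) (n : ℤ), Valued.v (jE t) = Valued.v (jE ϖ) ^ n ↔ Valued.v t = Valued.v ϖ ^ n)
    (hϖmax : ∀ t : M, ρ t = t → Valued.v t < 1 → Valued.v t ≤ Valued.v (jE ϖ))
    (φ : (Fin 2 → E) →+ M) (hφs : ∀ (c : E) (x : Fin 2 → E), φ (c • x) = jE c * φ x) (hφi : Function.Injective φ) (hφo : Function.Surjective φ)
    {γ₂ : GL (Fin 2) E} {lam h : M} (hφγ : ∀ x, φ ((γ₂ : Matrix (Fin 2) (Fin 2) E).mulVec x) = lam * φ x) (hlam : Valued.v lam = 1)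
    (hΘh : Θ h = h) (hh : h ≠ 0) (hform : ∀ x y, jE (pairing σ H₂ x y) = h * Θ (φ x) * φ y + ρ (h * Θ (φ x) * φ y))
    (u : E) {b : ℕ} (hb : 1 ≤ b) (hdb : d ≤ b) {j : ℕ} (hlamj : IsOrd ρ α (jE ϖ ^ j) lam)
    (f : ℕ → ℕ → AddSubgroup M → ℕ)
    (hf : ∀ (b j : ℕ) (Λ : AddSubgroup M) (x₀ : M) (r : E), 1 ≤ b → x₀ ≠ 0 →
      (∀ x, x ∈ Λ ↔ ∃ z, IsOrd ρ α (jE ϖ ^ j) z ∧ x = x₀ * z) →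
      IsOrd ρ α (jE ϖ ^ j) (dualGen ρ Θ α (jE ϖ ^ j) h x₀) → ¬ IsOrd ρ α (jE ϖ ^ j) (dualGen ρ Θ α (jE ϖ ^ j) h x₀ / jE ϖ) →
      Valued.v (dualGen ρ Θ α (jE ϖ ^ j) h x₀) = Valued.v (jE ϖ) ^ b →
      (∀ b', (∀ x ∈ Λ, Valued.v (h * Θ x * b' + ρ (h * Θ x * b')) ≤ 1) → (lam - jE u) * b' ∈ Λ) →
      IsOrd ρ α (jE ϖ ^ j) lam → jE r = glueUnit ρ Θ α (jE ϖ ^ j) h (jE ϖ) (jE hW) x₀ b →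
      f b j Λ = Nat.card {x : 𝒪[E] ⧸ 𝓂[E] ^ (2 * b) // ∃ u' : 𝒪[E], Ideal.Quotient.mk (𝓂[E] ^ (2 * b)) u' = x ∧
        Valued.v ((u' : E) * σ u' - r) ≤ Valued.v (ϖ ^ (2 * b))})
    -- the cell letters
    (hjiso : ∀ a, Valued.v (jE a) = Valued.v a)
    (hcell : levelSetDep ρ Θ α (jE ϖ) h j b (lam - jE u) = levelSet ρ Θ α (jE ϖ) h j b) (hfin : (levelSet ρ Θ α (jE ϖ) h j b).Finite)
    -- the fibration letters of ★ p863197 §1, in the consumer's currency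
    (CLS : M → Prop) (Vf : M → M) (ε : Prop) (r : ℤᵐ⁰)
    (Rd : Finset E) (hRd2 : ∀ V : E, σ V = V → Valued.v V ≤ 1 → ∃ V₀ ∈ Rd, Valued.v (V - V₀) ≤ r)
    (hRd3 : ∀ V ∈ Rd, ∀ V' ∈ Rd, Valued.v (V - V') ≤ r → V = V')
    (LIT NX ψ : E → Prop) [DecidablePred LIT] [DecidablePred NX] [DecidablePred ψ]
    (hI : ∀ (Λ : AddSubgroup M) (x₀ x₀' : M), (x₀ ≠ 0 ∧ (∀ x, x ∈ Λ ↔ ∃ ζ, IsOrd ρ α (jE ϖ ^ j) ζ ∧ x = x₀ * ζ) ∧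
        IsOrd ρ α (jE ϖ ^ j) (dualGen ρ Θ α (jE ϖ ^ j) h x₀) ∧ ¬ IsOrd ρ α (jE ϖ ^ j) (dualGen ρ Θ α (jE ϖ ^ j) h x₀ / jE ϖ) ∧
        Valued.v (dualGen ρ Θ α (jE ϖ ^ j) h x₀) = Valued.v (jE ϖ) ^ b) → (x₀' ≠ 0 ∧ (∀ x, x ∈ Λ ↔ ∃ ζ, IsOrd ρ α (jE ϖ ^ j) ζ ∧ x = x₀' * ζ) ∧
        IsOrd ρ α (jE ϖ ^ j) (dualGen ρ Θ α (jE ϖ ^ j) h x₀') ∧ ¬ IsOrd ρ α (jE ϖ ^ j) (dualGen ρ Θ α (jE ϖ ^ j) h x₀' / jE ϖ) ∧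
        Valued.v (dualGen ρ Θ α (jE ϖ ^ j) h x₀') = Valued.v (jE ϖ) ^ b) → (CLS x₀ ↔ CLS x₀') ∧ Valued.v (Vf x₀' - Vf x₀) ≤ r)
    (hV : ∀ (Λ : AddSubgroup M) (x₀ : M), (x₀ ≠ 0 ∧ (∀ x, x ∈ Λ ↔ ∃ ζ, IsOrd ρ α (jE ϖ ^ j) ζ ∧ x = x₀ * ζ) ∧
        IsOrd ρ α (jE ϖ ^ j) (dualGen ρ Θ α (jE ϖ ^ j) h x₀) ∧ ¬ IsOrd ρ α (jE ϖ ^ j) (dualGen ρ Θ α (jE ϖ ^ j) h x₀ / jE ϖ) ∧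
        Valued.v (dualGen ρ Θ α (jE ϖ ^ j) h x₀) = Valued.v (jE ϖ) ^ b) → ∃ Ve : E, jE Ve = Vf x₀ ∧ σ Ve = Ve ∧ Valued.v Ve ≤ 1)
    (hLit : ∀ (Λ : AddSubgroup M) (x₀ : M) (V₀ : E), (x₀ ≠ 0 ∧ (∀ x, x ∈ Λ ↔ ∃ ζ, IsOrd ρ α (jE ϖ ^ j) ζ ∧ x = x₀ * ζ) ∧
        IsOrd ρ α (jE ϖ ^ j) (dualGen ρ Θ α (jE ϖ ^ j) h x₀) ∧ ¬ IsOrd ρ α (jE ϖ ^ j) (dualGen ρ Θ α (jE ϖ ^ j) h x₀ / jE ϖ) ∧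
        Valued.v (dualGen ρ Θ α (jE ϖ ^ j) h x₀) = Valued.v (jE ϖ) ^ b) → V₀ ∈ Rd → Valued.v (Vf x₀ - jE V₀) ≤ r → LIT V₀)
    (hNX : ∀ Ve V₀ : E, σ Ve = Ve → Valued.v Ve ≤ 1 → V₀ ∈ Rd → Valued.v (Ve - V₀) ≤ r → (NX Ve ↔ NX V₀))
    (hψ : ∀ Ve V₀ : E, σ Ve = Ve → Valued.v Ve ≤ 1 → V₀ ∈ Rd → Valued.v (Ve - V₀) ≤ r → (ψ Ve ↔ ψ V₀))
    (hF : ∀ y ∈ Rd.filter LIT, ∀ y' ∈ Rd.filter LIT,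
      {Λ : AddSubgroup M | ∃ x₀, (x₀ ≠ 0 ∧ (∀ x, x ∈ Λ ↔ ∃ ζ, IsOrd ρ α (jE ϖ ^ j) ζ ∧ x = x₀ * ζ) ∧
        IsOrd ρ α (jE ϖ ^ j) (dualGen ρ Θ α (jE ϖ ^ j) h x₀) ∧ ¬ IsOrd ρ α (jE ϖ ^ j) (dualGen ρ Θ α (jE ϖ ^ j) h x₀ / jE ϖ) ∧
        Valued.v (dualGen ρ Θ α (jE ϖ ^ j) h x₀) = Valued.v (jE ϖ) ^ b) ∧ (CLS x₀ ↔ ε) ∧ Valued.v (Vf x₀ - jE y) ≤ r}.ncard =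
        {Λ : AddSubgroup M | ∃ x₀, (x₀ ≠ 0 ∧ (∀ x, x ∈ Λ ↔ ∃ ζ, IsOrd ρ α (jE ϖ ^ j) ζ ∧ x = x₀ * ζ) ∧
        IsOrd ρ α (jE ϖ ^ j) (dualGen ρ Θ α (jE ϖ ^ j) h x₀) ∧ ¬ IsOrd ρ α (jE ϖ ^ j) (dualGen ρ Θ α (jE ϖ ^ j) h x₀ / jE ϖ) ∧
        Valued.v (dualGen ρ Θ α (jE ϖ ^ j) h x₀) = Valued.v (jE ϖ) ^ b) ∧ (CLS x₀ ↔ ε) ∧ Valued.v (Vf x₀ - jE y') ≤ r}.ncard)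
    -- the cell predicates and the three reads
    (P₁ Q₁ : AddSubgroup M → Prop)
    (hP : ∀ (Λ : AddSubgroup M) (x₀ : M), (x₀ ≠ 0 ∧ (∀ x, x ∈ Λ ↔ ∃ ζ, IsOrd ρ α (jE ϖ ^ j) ζ ∧ x = x₀ * ζ) ∧
        IsOrd ρ α (jE ϖ ^ j) (dualGen ρ Θ α (jE ϖ ^ j) h x₀) ∧ ¬ IsOrd ρ α (jE ϖ ^ j) (dualGen ρ Θ α (jE ϖ ^ j) h x₀ / jE ϖ) ∧
        Valued.v (dualGen ρ Θ α (jE ϖ ^ j) h x₀) = Valued.v (jE ϖ) ^ b) → (f b j Λ ≠ 0 ↔ (CLS x₀ ↔ ε)))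
    (hL₁ : ∀ (Λ : AddSubgroup M) (x₀ : M), (x₀ ≠ 0 ∧ (∀ x, x ∈ Λ ↔ ∃ ζ, IsOrd ρ α (jE ϖ ^ j) ζ ∧ x = x₀ * ζ) ∧
        IsOrd ρ α (jE ϖ ^ j) (dualGen ρ Θ α (jE ϖ ^ j) h x₀) ∧ ¬ IsOrd ρ α (jE ϖ ^ j) (dualGen ρ Θ α (jE ϖ ^ j) h x₀ / jE ϖ) ∧
        Valued.v (dualGen ρ Θ α (jE ϖ ^ j) h x₀) = Valued.v (jE ϖ) ^ b) → f b j Λ ≠ 0 → (P₁ Λ ↔ ∃ Ve : E, jE Ve = Vf x₀ ∧ NX Ve ∧ ψ Ve))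
    (hL₂ : ∀ (Λ : AddSubgroup M) (x₀ : M), (x₀ ≠ 0 ∧ (∀ x, x ∈ Λ ↔ ∃ ζ, IsOrd ρ α (jE ϖ ^ j) ζ ∧ x = x₀ * ζ) ∧
        IsOrd ρ α (jE ϖ ^ j) (dualGen ρ Θ α (jE ϖ ^ j) h x₀) ∧ ¬ IsOrd ρ α (jE ϖ ^ j) (dualGen ρ Θ α (jE ϖ ^ j) h x₀ / jE ϖ) ∧
        Valued.v (dualGen ρ Θ α (jE ϖ ^ j) h x₀) = Valued.v (jE ϖ) ^ b) → f b j Λ ≠ 0 → (Q₁ Λ ↔ ∃ Ve : E, jE Ve = Vf x₀ ∧ NX Ve ∧ ¬ ψ Ve)) :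
    (((∑ᶠ Λ ∈ levelSetDep ρ Θ α (jE ϖ) h j b (lam - jE u) ∩ {Λ | P₁ Λ}, f b j Λ : ℕ) : ℤ) -
        ((∑ᶠ Λ ∈ levelSetDep ρ Θ α (jE ϖ) h j b (lam - jE u) ∩ {Λ | Q₁ Λ}, f b j Λ : ℕ) : ℤ)) * ((Rd.filter LIT).card : ℤ) =
      ((∑ᶠ Λ ∈ levelSetDep ρ Θ α (jE ϖ) h j b (lam - jE u), f b j Λ : ℕ) : ℤ) * ∑ V ∈ (Rd.filter LIT).filter NX, (if ψ V then (1 : ℤ) else -1) := by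
  -- the three weighted counts are `2q^b ·` the populated labelled counts (★ `…FaceTubeAbove`)
  have hw := finsum_levelSetDep_inter_weight_eq_two_mul_pow_mul_ncard_of_le σ hσ hvσ hϖ hD h2v hH₂σ hhW hhWσ jE hρρ hvρ hα hα1 hint hΘΘ hΘρ hvΘ hΘj hjv hjfix hjpow hϖmax
    φ hφs hφi hφo hφγ hlam hΘh hh hform u hb hdb hlamj f hf
  have hall : ∑ᶠ Λ ∈ levelSetDep ρ Θ α (jE ϖ) h j b (lam - jE u), f b j Λ = ∑ᶠ Λ ∈ levelSetDep ρ Θ α (jE ϖ) h j b (lam - jE u) ∩ {Λ | True}, f b j Λ := by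
    rw [show ({Λ | True} : Set (AddSubgroup M)) = Set.univ from Set.setOf_true, Set.inter_univ]
  rw [hall, hw P₁, hw Q₁, hw (fun _ => True)]
  -- the populated labelled parts are §1's sets (as in ★ p863833)
  have hsep : ∀ (P : AddSubgroup M → Prop) (φ' : E → Prop),
      (∀ (Λ : AddSubgroup M) (x₀ : M), (x₀ ≠ 0 ∧ (∀ x, x ∈ Λ ↔ ∃ ζ, IsOrd ρ α (jE ϖ ^ j) ζ ∧ x = x₀ * ζ) ∧
        IsOrd ρ α (jE ϖ ^ j) (dualGen ρ Θ α (jE ϖ ^ j) h x₀) ∧ ¬ IsOrd ρ α (jE ϖ ^ j) (dualGen ρ Θ α (jE ϖ ^ j) h x₀ / jE ϖ) ∧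
        Valued.v (dualGen ρ Θ α (jE ϖ ^ j) h x₀) = Valued.v (jE ϖ) ^ b) → f b j Λ ≠ 0 → (P Λ ↔ ∃ Ve : E, jE Ve = Vf x₀ ∧ φ' Ve)) →
      {Λ ∈ levelSetDep ρ Θ α (jE ϖ) h j b (lam - jE u) | P Λ ∧ f b j Λ ≠ 0} =
        {Λ : AddSubgroup M | ∃ x₀ : M, (x₀ ≠ 0 ∧ (∀ x, x ∈ Λ ↔ ∃ ζ, IsOrd ρ α (jE ϖ ^ j) ζ ∧ x = x₀ * ζ) ∧
        IsOrd ρ α (jE ϖ ^ j) (dualGen ρ Θ α (jE ϖ ^ j) h x₀) ∧ ¬ IsOrd ρ α (jE ϖ ^ j) (dualGen ρ Θ α (jE ϖ ^ j) h x₀ / jE ϖ) ∧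
        Valued.v (dualGen ρ Θ α (jE ϖ ^ j) h x₀) = Valued.v (jE ϖ) ^ b) ∧ (CLS x₀ ↔ ε) ∧ ∃ Ve : E, jE Ve = Vf x₀ ∧ φ' Ve} := by
    intro P φ' hL
    rw [hcell]
    ext Λ
    rw [Set.mem_sep_iff, mem_levelSet_iff, Set.mem_setOf_eq]
    constructor
    · rintro ⟨⟨x₀, hG⟩, hPΛ, hw0⟩
      exact ⟨x₀, hG, (hP Λ x₀ hG).1 hw0, (hL Λ x₀ hG hw0).1 hPΛ⟩
    · rintro ⟨x₀, hG, hC, hVe⟩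
      have hw0 : f b j Λ ≠ 0 := (hP Λ x₀ hG).2 hC
      exact ⟨⟨x₀, hG⟩, (hL Λ x₀ hG hw0).2 hVe, hw0⟩
  -- the populated part is §1's class `S`
  have hpopS : {Λ ∈ levelSetDep ρ Θ α (jE ϖ) h j b (lam - jE u) | True ∧ f b j Λ ≠ 0} =
      {Λ : AddSubgroup M | ∃ x₀ : M, (x₀ ≠ 0 ∧ (∀ x, x ∈ Λ ↔ ∃ ζ, IsOrd ρ α (jE ϖ ^ j) ζ ∧ x = x₀ * ζ) ∧
        IsOrd ρ α (jE ϖ ^ j) (dualGen ρ Θ α (jE ϖ ^ j) h x₀) ∧ ¬ IsOrd ρ α (jE ϖ ^ j) (dualGen ρ Θ α (jE ϖ ^ j) h x₀ / jE ϖ) ∧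
        Valued.v (dualGen ρ Θ α (jE ϖ ^ j) h x₀) = Valued.v (jE ϖ) ^ b) ∧ (CLS x₀ ↔ ε)} := by
    rw [hcell]
    ext Λ
    rw [Set.mem_sep_iff, mem_levelSet_iff, Set.mem_setOf_eq, true_and]
    constructor
    · rintro ⟨⟨x₀, hG⟩, hw0⟩
      exact ⟨x₀, hG, (hP Λ x₀ hG).1 hw0⟩
    · rintro ⟨x₀, hG, hC⟩
      exact ⟨⟨x₀, hG⟩, (hP Λ x₀ hG).2 hC⟩
  rw [hsep P₁ (fun V => NX V ∧ ψ V) hL₁, hsep Q₁ (fun V => NX V ∧ ¬ ψ V) hL₂, hpopS]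
  have key := ncardDiff_mul_card_eq_ncard_mul_sum_of_digit_fibration (σ := σ) (X := AddSubgroup M)
    (fun (Λ : AddSubgroup M) (x₀ : M) => (x₀ ≠ 0 ∧ (∀ x, x ∈ Λ ↔ ∃ ζ, IsOrd ρ α (jE ϖ ^ j) ζ ∧ x = x₀ * ζ) ∧
        IsOrd ρ α (jE ϖ ^ j) (dualGen ρ Θ α (jE ϖ ^ j) h x₀) ∧ ¬ IsOrd ρ α (jE ϖ ^ j) (dualGen ρ Θ α (jE ϖ ^ j) h x₀ / jE ϖ) ∧
        Valued.v (dualGen ρ Θ α (jE ϖ ^ j) h x₀) = Valued.v (jE ϖ) ^ b))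
    CLS Vf ε jE hjiso r Rd hRd2 hRd3 LIT NX ψ hI hV hLit hNX hψ hF hfin
  push_cast
  linear_combination (2 * (Nat.card 𝓀[E] : ℤ) ^ b) * key

/-! ## §3 HEAD′ — the displayed form with a sign read `(ψ V ? 1 : −1) = p · ω V` -/

omit [Valued E ℤᵐ⁰] in
/-- **THE `±1` BOOKKEEPING OF TWO NORM SIGNS**: `(ω(x) = ω(y) ? 1 : −1) = ω(y)·ω(x)` for `ω = normSign σ ∈ {1, −1}` (so a label `ψ V :≡ ω(α₁ + γ₁V) = ω(−h_W)` — ★ p863628 ∕ ★ p863914 §3 — reads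
`(ψ V ? 1 : −1) = ω(−h_W)·ω(α₁ + γ₁V)`). [cite: Serre1979, Ch. V §3 Prop. 5, Cor. 2–3 pp. 84–86] -/
theorem ite_eq_normSign_mul_normSign (τ : E →+* E) (x y : E) :
    (if normSign τ x = normSign τ y then (1 : ℤ) else -1) = normSign τ y * normSign τ x := by
  unfold normSign
  split_ifs <;> simp_all

/-- **HEAD′ — «THE PER-CELL LAW», DISPLAYED FORM (K6-0, β₂ WORD #32 verbatim up to the letters' currency).**  §2's frame + a sign `p : ℤ` and a character `ω : E → ℤ` with the pointwise read
`hω : ∀ V ∈ Rd, LIT V → NX V → (ψ V ? 1 : −1) = p · ω V` on the labelled literal digits (for `ψ V :≡ ω(α₁ + γ₁V) = ω(−h_W)`: `p = ω(−h_W)`, `ω V = ω(α₁ + γ₁V)`, §3 `ite_eq_normSign_mul_normSign`).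
THEN `X(cell) · #(Rd.filter LIT) = n(cell) · (p · Σ_{V ∈ (Rd.filter LIT).filter NX} ω V)` — «`X_lit(cell)·#(Rd ∩ LIT ∩ shell) = n_lit(cell)·p_lit·Σ_V ω(α₁ + γ₁V)`» with `n_lit = Σᶠ_{cell} f`
(the weighted size; with the unweighted `#cell` one multiplies both sides by `2` via ★ p863565's halves — not needed by the letters).
[cite: Kottwitz1986BaseChangeUnits, §1 pp. 240–241] [cite: LabesseLanglands1979, §2 (2.2) p. 9] [cite: Rogawski1990, §4.9 Prop. 4.9.1 (b) p. 55] -/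
theorem cellDiff_mul_card_eq_cellCount_mul_signSum_of_fibration_reads₃ [CompleteSpace E] [IsDiscreteValuationRing 𝒪[E]] [Finite 𝓀[E]]
    (σ : E →+* E) (hσ : ∀ a, σ (σ a) = a) (hvσ : ∀ a, Valued.v (σ a) = Valued.v a)
    {ϖ : E} (hϖ : Valued.v ϖ = WithZero.exp (-1 : ℤ)) {d t : ℕ} (hD : IsRamifiedQuadraticDatum σ ϖ d t) (h2v : Valued.v (2 : E) < 1)
    {H₂ : Matrix (Fin 2) (Fin 2) E} (hH₂σ : (H₂.map σ)ᵀ = H₂) {hW : E} (hhW : Valued.v hW = 1) (hhWσ : σ hW = hW) (jE : E →+* M)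
    (hρρ : ∀ x, ρ (ρ x) = x) (hvρ : ∀ x, Valued.v (ρ x) = Valued.v x) (hα : ρ α ≠ α) (hα1 : Valued.v α ≤ 1)
    (hint : ∀ z : M, Valued.v z ≤ 1 → Valued.v ((z - ρ z) / (α - ρ α)) ≤ 1)
    (hΘΘ : ∀ x, Θ (Θ x) = x) (hΘρ : ∀ x, Θ (ρ x) = ρ (Θ x)) (hvΘ : ∀ x, Valued.v (Θ x) = Valued.v x) (hΘj : ∀ x, Θ (jE x) = jE (σ x))
    (hjv : ∀ c, Valued.v (jE c) ≤ 1 ↔ Valued.v c ≤ 1) (hjfix : ∀ z, ρ z = z ↔ ∃ c, jE c = z)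
    (hjpow : ∀ (t : E) (n : ℤ), Valued.v (jE t) = Valued.v (jE ϖ) ^ n ↔ Valued.v t = Valued.v ϖ ^ n)
    (hϖmax : ∀ t : M, ρ t = t → Valued.v t < 1 → Valued.v t ≤ Valued.v (jE ϖ))
    (φ : (Fin 2 → E) →+ M) (hφs : ∀ (c : E) (x : Fin 2 → E), φ (c • x) = jE c * φ x) (hφi : Function.Injective φ) (hφo : Function.Surjective φ)
    {γ₂ : GL (Fin 2) E} {lam h : M} (hφγ : ∀ x, φ ((γ₂ : Matrix (Fin 2) (Fin 2) E).mulVec x) = lam * φ x) (hlam : Valued.v lam = 1)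
    (hΘh : Θ h = h) (hh : h ≠ 0) (hform : ∀ x y, jE (pairing σ H₂ x y) = h * Θ (φ x) * φ y + ρ (h * Θ (φ x) * φ y))
    (u : E) {b : ℕ} (hb : 1 ≤ b) (hdb : d ≤ b) {j : ℕ} (hlamj : IsOrd ρ α (jE ϖ ^ j) lam)
    (f : ℕ → ℕ → AddSubgroup M → ℕ)
    (hf : ∀ (b j : ℕ) (Λ : AddSubgroup M) (x₀ : M) (r : E), 1 ≤ b → x₀ ≠ 0 →
      (∀ x, x ∈ Λ ↔ ∃ z, IsOrd ρ α (jE ϖ ^ j) z ∧ x = x₀ * z) →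
      IsOrd ρ α (jE ϖ ^ j) (dualGen ρ Θ α (jE ϖ ^ j) h x₀) → ¬ IsOrd ρ α (jE ϖ ^ j) (dualGen ρ Θ α (jE ϖ ^ j) h x₀ / jE ϖ) →
      Valued.v (dualGen ρ Θ α (jE ϖ ^ j) h x₀) = Valued.v (jE ϖ) ^ b →
      (∀ b', (∀ x ∈ Λ, Valued.v (h * Θ x * b' + ρ (h * Θ x * b')) ≤ 1) → (lam - jE u) * b' ∈ Λ) →
      IsOrd ρ α (jE ϖ ^ j) lam → jE r = glueUnit ρ Θ α (jE ϖ ^ j) h (jE ϖ) (jE hW) x₀ b →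
      f b j Λ = Nat.card {x : 𝒪[E] ⧸ 𝓂[E] ^ (2 * b) // ∃ u' : 𝒪[E], Ideal.Quotient.mk (𝓂[E] ^ (2 * b)) u' = x ∧
        Valued.v ((u' : E) * σ u' - r) ≤ Valued.v (ϖ ^ (2 * b))})
    (hjiso : ∀ a, Valued.v (jE a) = Valued.v a)
    (hcell : levelSetDep ρ Θ α (jE ϖ) h j b (lam - jE u) = levelSet ρ Θ α (jE ϖ) h j b) (hfin : (levelSet ρ Θ α (jE ϖ) h j b).Finite)
    (CLS : M → Prop) (Vf : M → M) (ε : Prop) (r : ℤᵐ⁰)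
    (Rd : Finset E) (hRd2 : ∀ V : E, σ V = V → Valued.v V ≤ 1 → ∃ V₀ ∈ Rd, Valued.v (V - V₀) ≤ r)
    (hRd3 : ∀ V ∈ Rd, ∀ V' ∈ Rd, Valued.v (V - V') ≤ r → V = V')
    (LIT NX ψ : E → Prop) [DecidablePred LIT] [DecidablePred NX] [DecidablePred ψ]
    (hI : ∀ (Λ : AddSubgroup M) (x₀ x₀' : M), (x₀ ≠ 0 ∧ (∀ x, x ∈ Λ ↔ ∃ ζ, IsOrd ρ α (jE ϖ ^ j) ζ ∧ x = x₀ * ζ) ∧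
        IsOrd ρ α (jE ϖ ^ j) (dualGen ρ Θ α (jE ϖ ^ j) h x₀) ∧ ¬ IsOrd ρ α (jE ϖ ^ j) (dualGen ρ Θ α (jE ϖ ^ j) h x₀ / jE ϖ) ∧
        Valued.v (dualGen ρ Θ α (jE ϖ ^ j) h x₀) = Valued.v (jE ϖ) ^ b) → (x₀' ≠ 0 ∧ (∀ x, x ∈ Λ ↔ ∃ ζ, IsOrd ρ α (jE ϖ ^ j) ζ ∧ x = x₀' * ζ) ∧
        IsOrd ρ α (jE ϖ ^ j) (dualGen ρ Θ α (jE ϖ ^ j) h x₀') ∧ ¬ IsOrd ρ α (jE ϖ ^ j) (dualGen ρ Θ α (jE ϖ ^ j) h x₀' / jE ϖ) ∧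
        Valued.v (dualGen ρ Θ α (jE ϖ ^ j) h x₀') = Valued.v (jE ϖ) ^ b) → (CLS x₀ ↔ CLS x₀') ∧ Valued.v (Vf x₀' - Vf x₀) ≤ r)
    (hV : ∀ (Λ : AddSubgroup M) (x₀ : M), (x₀ ≠ 0 ∧ (∀ x, x ∈ Λ ↔ ∃ ζ, IsOrd ρ α (jE ϖ ^ j) ζ ∧ x = x₀ * ζ) ∧
        IsOrd ρ α (jE ϖ ^ j) (dualGen ρ Θ α (jE ϖ ^ j) h x₀) ∧ ¬ IsOrd ρ α (jE ϖ ^ j) (dualGen ρ Θ α (jE ϖ ^ j) h x₀ / jE ϖ) ∧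
        Valued.v (dualGen ρ Θ α (jE ϖ ^ j) h x₀) = Valued.v (jE ϖ) ^ b) → ∃ Ve : E, jE Ve = Vf x₀ ∧ σ Ve = Ve ∧ Valued.v Ve ≤ 1)
    (hLit : ∀ (Λ : AddSubgroup M) (x₀ : M) (V₀ : E), (x₀ ≠ 0 ∧ (∀ x, x ∈ Λ ↔ ∃ ζ, IsOrd ρ α (jE ϖ ^ j) ζ ∧ x = x₀ * ζ) ∧
        IsOrd ρ α (jE ϖ ^ j) (dualGen ρ Θ α (jE ϖ ^ j) h x₀) ∧ ¬ IsOrd ρ α (jE ϖ ^ j) (dualGen ρ Θ α (jE ϖ ^ j) h x₀ / jE ϖ) ∧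
        Valued.v (dualGen ρ Θ α (jE ϖ ^ j) h x₀) = Valued.v (jE ϖ) ^ b) → V₀ ∈ Rd → Valued.v (Vf x₀ - jE V₀) ≤ r → LIT V₀)
    (hNX : ∀ Ve V₀ : E, σ Ve = Ve → Valued.v Ve ≤ 1 → V₀ ∈ Rd → Valued.v (Ve - V₀) ≤ r → (NX Ve ↔ NX V₀))
    (hψ : ∀ Ve V₀ : E, σ Ve = Ve → Valued.v Ve ≤ 1 → V₀ ∈ Rd → Valued.v (Ve - V₀) ≤ r → (ψ Ve ↔ ψ V₀))
    (hF : ∀ y ∈ Rd.filter LIT, ∀ y' ∈ Rd.filter LIT,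
      {Λ : AddSubgroup M | ∃ x₀, (x₀ ≠ 0 ∧ (∀ x, x ∈ Λ ↔ ∃ ζ, IsOrd ρ α (jE ϖ ^ j) ζ ∧ x = x₀ * ζ) ∧
        IsOrd ρ α (jE ϖ ^ j) (dualGen ρ Θ α (jE ϖ ^ j) h x₀) ∧ ¬ IsOrd ρ α (jE ϖ ^ j) (dualGen ρ Θ α (jE ϖ ^ j) h x₀ / jE ϖ) ∧
        Valued.v (dualGen ρ Θ α (jE ϖ ^ j) h x₀) = Valued.v (jE ϖ) ^ b) ∧ (CLS x₀ ↔ ε) ∧ Valued.v (Vf x₀ - jE y) ≤ r}.ncard =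
        {Λ : AddSubgroup M | ∃ x₀, (x₀ ≠ 0 ∧ (∀ x, x ∈ Λ ↔ ∃ ζ, IsOrd ρ α (jE ϖ ^ j) ζ ∧ x = x₀ * ζ) ∧
        IsOrd ρ α (jE ϖ ^ j) (dualGen ρ Θ α (jE ϖ ^ j) h x₀) ∧ ¬ IsOrd ρ α (jE ϖ ^ j) (dualGen ρ Θ α (jE ϖ ^ j) h x₀ / jE ϖ) ∧
        Valued.v (dualGen ρ Θ α (jE ϖ ^ j) h x₀) = Valued.v (jE ϖ) ^ b) ∧ (CLS x₀ ↔ ε) ∧ Valued.v (Vf x₀ - jE y') ≤ r}.ncard)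
    (P₁ Q₁ : AddSubgroup M → Prop)
    (hP : ∀ (Λ : AddSubgroup M) (x₀ : M), (x₀ ≠ 0 ∧ (∀ x, x ∈ Λ ↔ ∃ ζ, IsOrd ρ α (jE ϖ ^ j) ζ ∧ x = x₀ * ζ) ∧
        IsOrd ρ α (jE ϖ ^ j) (dualGen ρ Θ α (jE ϖ ^ j) h x₀) ∧ ¬ IsOrd ρ α (jE ϖ ^ j) (dualGen ρ Θ α (jE ϖ ^ j) h x₀ / jE ϖ) ∧
        Valued.v (dualGen ρ Θ α (jE ϖ ^ j) h x₀) = Valued.v (jE ϖ) ^ b) → (f b j Λ ≠ 0 ↔ (CLS x₀ ↔ ε)))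
    (hL₁ : ∀ (Λ : AddSubgroup M) (x₀ : M), (x₀ ≠ 0 ∧ (∀ x, x ∈ Λ ↔ ∃ ζ, IsOrd ρ α (jE ϖ ^ j) ζ ∧ x = x₀ * ζ) ∧
        IsOrd ρ α (jE ϖ ^ j) (dualGen ρ Θ α (jE ϖ ^ j) h x₀) ∧ ¬ IsOrd ρ α (jE ϖ ^ j) (dualGen ρ Θ α (jE ϖ ^ j) h x₀ / jE ϖ) ∧
        Valued.v (dualGen ρ Θ α (jE ϖ ^ j) h x₀) = Valued.v (jE ϖ) ^ b) → f b j Λ ≠ 0 → (P₁ Λ ↔ ∃ Ve : E, jE Ve = Vf x₀ ∧ NX Ve ∧ ψ Ve))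
    (hL₂ : ∀ (Λ : AddSubgroup M) (x₀ : M), (x₀ ≠ 0 ∧ (∀ x, x ∈ Λ ↔ ∃ ζ, IsOrd ρ α (jE ϖ ^ j) ζ ∧ x = x₀ * ζ) ∧
        IsOrd ρ α (jE ϖ ^ j) (dualGen ρ Θ α (jE ϖ ^ j) h x₀) ∧ ¬ IsOrd ρ α (jE ϖ ^ j) (dualGen ρ Θ α (jE ϖ ^ j) h x₀ / jE ϖ) ∧
        Valued.v (dualGen ρ Θ α (jE ϖ ^ j) h x₀) = Valued.v (jE ϖ) ^ b) → f b j Λ ≠ 0 → (Q₁ Λ ↔ ∃ Ve : E, jE Ve = Vf x₀ ∧ NX Ve ∧ ¬ ψ Ve))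
    -- the sign read
    (p : ℤ) (ω : E → ℤ) (hω : ∀ V ∈ Rd, LIT V → NX V → (if ψ V then (1 : ℤ) else -1) = p * ω V) :
    (((∑ᶠ Λ ∈ levelSetDep ρ Θ α (jE ϖ) h j b (lam - jE u) ∩ {Λ | P₁ Λ}, f b j Λ : ℕ) : ℤ) -
        ((∑ᶠ Λ ∈ levelSetDep ρ Θ α (jE ϖ) h j b (lam - jE u) ∩ {Λ | Q₁ Λ}, f b j Λ : ℕ) : ℤ)) * ((Rd.filter LIT).card : ℤ) =
      ((∑ᶠ Λ ∈ levelSetDep ρ Θ α (jE ϖ) h j b (lam - jE u), f b j Λ : ℕ) : ℤ) * (p * ∑ V ∈ (Rd.filter LIT).filter NX, ω V) := by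
  rw [cellDiff_mul_card_eq_cellCount_mul_sum_of_fibration_reads₃ σ hσ hvσ hϖ hD h2v hH₂σ hhW hhWσ jE hρρ hvρ hα hα1 hint hΘΘ hΘρ hvΘ hΘj hjv hjfix hjpow hϖmax
    φ hφs hφi hφo hφγ hlam hΘh hh hform u hb hdb hlamj f hf hjiso hcell hfin CLS Vf ε r Rd hRd2 hRd3 LIT NX ψ hI hV hLit hNX hψ hF P₁ Q₁ hP hL₁ hL₂,
    Finset.mul_sum ((Rd.filter LIT).filter NX) ω p]
  congr 1
  refine sum_congr rfl fun V hV => ?_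
  obtain ⟨hV', hNXV⟩ := mem_filter.1 hV
  obtain ⟨hVR, hLV⟩ := mem_filter.1 hV'
  exact hω V hVR hLV hNXV

end Summit.HodgeConjecture.HodgeConjecture.Cruxes.H413.F0P3cDyRamConeCellPerCellLaw

end
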